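import Summits.MatrixMultiplication.OmegaCensus.STPP222CubeExponent
import Summits.MatrixMultiplication.OmegaCensus.STPPDisjointPacking

/-!
# ω-census, STPP law `(2,2,2)^k`: a uniform integer family — every `ℤ/mℤ` with `m ≥ 8k(k−1)+8` admits `k` simultaneous-TPP triples of 2-subsets

HONEST FRAMING (pub-omega census; verbatim): lottery ticket; floor = certified bounds/negative ranges.
Census STRUCTURE bookkeeping (question Q7 of `STRUCTURE.md`: the threshold function `N_k`), not progress on `ω`:
a `(2,2,2)^k` STPP family gives no matrix-multiplication bound of interest.

THE FAMILY (integers; `i = 0, …, k−1`):  `Aᵢ = {0, 1}`, `Bᵢ = {8k·i, 8k·i + 2}`, `Cᵢ = {8i, 8i + 4}`.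
Every constraint expression of CKSU Def. 5.1 (tree form `IsSTPP`: `(s'−s)+(t'−t)+(u'−u)` with `s' ∈ Aᵢ, s ∈ A_l,
t ∈ Bᵢ, t' ∈ Bⱼ, u ∈ Cⱼ, u' ∈ C_l`) equals `8·(k(j−i) + (l−j)) + ε` with `ε = e₁+e₂+e₃`, `e₁ ∈ {0,±1}`, `e₂ ∈ {0,±2}`,
`e₃ ∈ {0,±4}`.  If it vanishes then `8 ∣ ε`, so `ε = 0`, so `e₁ = e₂ = e₃ = 0` (binary digits) and `k(j−i) = j−l` with
`|j−l| ≤ k−1`, forcing `i = j = l`: the family is an STPP family in `ℤ` for EVERY `k`, and all its expressions have absolute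
value `≤ 8k(k−1)+7`.  Reducing modulo `m > 8k(k−1)+7` (a vanishing residue of an integer of absolute value `< m` is a
vanishing integer) gives:

* `isSTPP_powFam` — the reduced family is an STPP family in `ZMod m` whenever `8k(k−1)+8 ≤ m`;
* `exists_isSTPP_222pow_zmod` — **for all `k` and all `m ≥ 8k(k−1)+8`, `ℤ/mℤ` admits `(2,2,2)^k`** (all `3k` sets of
  cardinality `2`);
* `exists_isSTPP_222pow_of_addOrderOf` / `_of_exponent` — hence so does every abelian group with an element of order
  (resp. every finite abelian group of exponent) `≥ 8k(k−1)+8` (transport along `ℤ/(ord g) ↪ G`, as in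
  `STPP222CubeExponent.lean`).

So the census threshold `N_k(cyclic)` (least order from which every cyclic group admits `(2,2,2)^k`) satisfies
`N_k(cyclic) ≤ 8k² − 8k + 8` — a quadratic UPPER law, proved symbolically in `k` (no `decide`).  No sharpness is claimed:
for `k = 3` the bound is `56` while the census onset is `46` (`STPP222CubeCyclic.lean`: `m ≥ 46`), and a single integer
family can do no better than `M_min + 1 = 45` there (ENG2 record `C4-REDUCTION-eng2.md` §3b).

References: H. Cohn, R. Kleinberg, B. Szegedy, C. Umans, FOCS 2005 (arXiv:math/0511460), Def. 5.1 (STPP).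
Record: pub-omega HOME `pub-omega-eng2/` (ENG2 gen 15, 2026-08-23), STRUCTURE.md Q7.
-/

open Literature.Computability.AlgebraicComplexity Finset

namespace Summit.MatrixMultiplication.OmegaCensus

/-! ## The family -/

/-- The 2-subset `{x, x + g}` of `ZMod m` cut out by an integer base point `x` and gap `g`. -/
def pairZ (m : ℕ) (x g : ℤ) : Finset (ZMod m) := {(x : ZMod m), ((x + g : ℤ) : ZMod m)}

/-- `A`-sets of the uniform `(2,2,2)^k` family in `ZMod m`: `Aᵢ = {0, 1}`. -/
def powFamA (m k : ℕ) : Fin k → Finset (ZMod m) := fun _ => pairZ m 0 1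

/-- `B`-sets of the uniform `(2,2,2)^k` family in `ZMod m`: `Bᵢ = {8k·i, 8k·i + 2}`. -/
def powFamB (m k : ℕ) : Fin k → Finset (ZMod m) := fun i => pairZ m (8 * ((k : ℤ) * ((i : ℕ) : ℤ))) 2

/-- `C`-sets of the uniform `(2,2,2)^k` family in `ZMod m`: `Cᵢ = {8i, 8i + 4}`. -/
def powFamC (m k : ℕ) : Fin k → Finset (ZMod m) := fun i => pairZ m (8 * ((i : ℕ) : ℤ)) 4

/-! ## Arithmetic core (integers) -/

/-- Differences of two elements of integer pairs `{x, x+g}`, `{x', x'+g}` reduced mod `m`: `s' − s = x' − x + e` with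
`e ∈ {−g, 0, g}`, and `e = 0 ∧ x = x'` forces `s = s'`. -/
theorem diff_of_mem_pair {m : ℕ} {x x' g : ℤ} {s s' : ZMod m}
    (hs : s = (x : ZMod m) ∨ s = ((x + g : ℤ) : ZMod m)) (hs' : s' = (x' : ZMod m) ∨ s' = ((x' + g : ℤ) : ZMod m)) :
    ∃ e : ℤ, (e = -g ∨ e = 0 ∨ e = g) ∧ s' - s = ((x' - x + e : ℤ) : ZMod m) ∧ (e = 0 → x = x' → s = s') := by
  rcases hs with rfl | rfl <;> rcases hs' with rfl | rfl
  · exact ⟨0, by simp, by push_cast; ring, fun _ h => by rw [h]⟩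
  · exact ⟨g, by simp, by push_cast; ring, fun h h' => by subst h; rw [h']; simp⟩
  · exact ⟨-g, by simp, by push_cast; ring, fun h h' => by
      have hg : g = 0 := by omega
      subst hg; rw [h']; simp⟩
  · exact ⟨0, by simp, by push_cast; ring, fun _ h => by rw [h]⟩

/-- The size bound: for `0 ≤ I, J, L < K` and digits `e₁ ∈ {0,±1}`, `e₂ ∈ {0,±2}`, `e₃ ∈ {0,±4}`, the expression
`e₁ + (8(KJ) − 8(KI) + e₂) + (8L − 8J + e₃)` lies strictly between `−M` and `M` as soon as `8K(K−1) + 8 ≤ M`. -/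
theorem powFam_expr_bound (K I J L e₁ e₂ e₃ M : ℤ) (hI : 0 ≤ I) (hIK : I < K) (hJ : 0 ≤ J) (hJK : J < K)
    (hL : 0 ≤ L) (hLK : L < K) (h1 : e₁ = -1 ∨ e₁ = 0 ∨ e₁ = 1) (h2 : e₂ = -2 ∨ e₂ = 0 ∨ e₂ = 2)
    (h3 : e₃ = -4 ∨ e₃ = 0 ∨ e₃ = 4) (hM : 8 * K * (K - 1) + 8 ≤ M) :
    -M < e₁ + (8 * (K * J) - 8 * (K * I) + e₂) + (8 * L - 8 * J + e₃) ∧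
      e₁ + (8 * (K * J) - 8 * (K * I) + e₂) + (8 * L - 8 * J + e₃) < M := by
  have hε : -7 ≤ e₁ + e₂ + e₃ ∧ e₁ + e₂ + e₃ ≤ 7 := by omega
  have hup : K * J - K * I + (L - J) ≤ K * (K - 1) := by
    nlinarith [mul_le_mul_of_nonneg_left (show J ≤ K - 1 by omega) (show (0:ℤ) ≤ K - 1 by omega),
      mul_nonneg (show (0:ℤ) ≤ K by omega) hI]
  have hlo : -(K * (K - 1)) ≤ K * J - K * I + (L - J) := by
    nlinarith [mul_le_mul_of_nonneg_left (show I ≤ K - 1 by omega) (show (0:ℤ) ≤ K by omega),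
      mul_nonneg (show (0:ℤ) ≤ K - 1 by omega) hJ]
  constructor <;> nlinarith

/-- The digit argument: if the expression vanishes then `i = j = l` and all digits are `0`. -/
theorem powFam_expr_eq_zero (K I J L e₁ e₂ e₃ : ℤ) (hI : 0 ≤ I) (hIK : I < K) (hJ : 0 ≤ J) (hJK : J < K)
    (hL : 0 ≤ L) (hLK : L < K) (h1 : e₁ = -1 ∨ e₁ = 0 ∨ e₁ = 1) (h2 : e₂ = -2 ∨ e₂ = 0 ∨ e₂ = 2)
    (h3 : e₃ = -4 ∨ e₃ = 0 ∨ e₃ = 4) (h : e₁ + (8 * (K * J) - 8 * (K * I) + e₂) + (8 * L - 8 * J + e₃) = 0) :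
    I = J ∧ J = L ∧ e₁ = 0 ∧ e₂ = 0 ∧ e₃ = 0 := by
  -- `8 ∣ e₁ + e₂ + e₃` and `|e₁ + e₂ + e₃| ≤ 7` force all digits to vanish
  have hP : K * J - K * I = J - L ∧ e₁ = 0 ∧ e₂ = 0 ∧ e₃ = 0 := by
    omega
  obtain ⟨hKJ, r1, r2, r3⟩ := hP
  have hIJ : I = J := by
    rcases lt_trichotomy I J with hlt | heq | hgt
    · have : K * (I + 1) ≤ K * J := mul_le_mul_of_nonneg_left (by omega) (by omega)
      nlinarith
    · exact heq
    · have : K * (J + 1) ≤ K * I := mul_le_mul_of_nonneg_left (by omega) (by omega)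
      nlinarith
  subst hIJ
  exact ⟨rfl, by nlinarith, r1, r2, r3⟩

/-! ## The STPP property and the cardinalities in `ZMod m` -/

/-- **The uniform family is an STPP family in `ZMod m` for `m ≥ 8k(k−1) + 8`.** Each difference is lifted to an
integer (`diff_of_mem_pair`); the vanishing residue is an integer multiple of `m` of absolute value `< m`
(`powFam_expr_bound`), hence the integer expression vanishes and `powFam_expr_eq_zero` applies.
[cite: CohnKleinbergSzegedyUmans2005, Def. 5.1] -/
theorem isSTPP_powFam (m k : ℕ) (hm : 8 * k * (k - 1) + 8 ≤ m) :
    IsSTPP (powFamA m k) (powFamB m k) (powFamC m k) := by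
  intro i j l s hs s' hs' t ht t' ht' u hu u' hu' heq
  simp only [powFamA, powFamB, powFamC, pairZ, Finset.mem_insert, Finset.mem_singleton] at hs hs' ht ht' hu hu'
  obtain ⟨e₁, he₁, hd₁, hq₁⟩ := diff_of_mem_pair hs hs'
  obtain ⟨e₂, he₂, hd₂, hq₂⟩ := diff_of_mem_pair ht ht'
  obtain ⟨e₃, he₃, hd₃, hq₃⟩ := diff_of_mem_pair hu hu'
  rw [hd₁, hd₂, hd₃] at heq
  have hE : ((e₁ + (8 * ((k : ℤ) * ((j : ℕ) : ℤ)) - 8 * ((k : ℤ) * ((i : ℕ) : ℤ)) + e₂) +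
      (8 * ((l : ℕ) : ℤ) - 8 * ((j : ℕ) : ℤ) + e₃) : ℤ) : ZMod m) = 0 := by
    rw [← heq]; push_cast; ring
  rw [ZMod.intCast_zmod_eq_zero_iff_dvd] at hE
  have hk1 : (1 : ℤ) ≤ k := by have := i.pos; omega
  have hI : (0:ℤ) ≤ (i : ℕ) ∧ ((i : ℕ) : ℤ) < k := ⟨by omega, by have := i.isLt; omega⟩
  have hJ : (0:ℤ) ≤ (j : ℕ) ∧ ((j : ℕ) : ℤ) < k := ⟨by omega, by have := j.isLt; omega⟩
  have hL : (0:ℤ) ≤ (l : ℕ) ∧ ((l : ℕ) : ℤ) < k := ⟨by omega, by have := l.isLt; omega⟩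
  have hM : 8 * (k : ℤ) * (k - 1) + 8 ≤ m := by
    have h' : ((8 * k * (k - 1) + 8 : ℕ) : ℤ) ≤ ((m : ℕ) : ℤ) := by exact_mod_cast hm
    have hk : ((k - 1 : ℕ) : ℤ) = (k : ℤ) - 1 := by omega
    push_cast [hk] at h'
    linarith
  have hb := powFam_expr_bound k i j l e₁ e₂ e₃ m hI.1 hI.2 hJ.1 hJ.2 hL.1 hL.2 he₁ he₂ he₃ hM
  have hz : e₁ + (8 * ((k : ℤ) * ((j : ℕ) : ℤ)) - 8 * ((k : ℤ) * ((i : ℕ) : ℤ)) + e₂) +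
      (8 * ((l : ℕ) : ℤ) - 8 * ((j : ℕ) : ℤ) + e₃) = (0 : ℤ) := by
    apply Int.eq_zero_of_dvd_of_natAbs_lt_natAbs hE
    simp only [Int.natAbs_natCast]
    omega
  obtain ⟨hij, hjl, r1, r2, r3⟩ := powFam_expr_eq_zero k i j l e₁ e₂ e₃ hI.1 hI.2 hJ.1 hJ.2 hL.1 hL.2 he₁ he₂ he₃ hz
  have hij' : i = j := Fin.ext (by exact_mod_cast hij)
  have hjl' : j = l := Fin.ext (by exact_mod_cast hjl)
  subst hij' hjl'
  exact ⟨rfl, rfl, hq₁ r1 rfl, hq₂ r2 rfl, hq₃ r3 rfl⟩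

/-- A pair `{x, x + g}` with `0 < g < m` reduces to a 2-element subset of `ZMod m`. -/
theorem card_pairZ {m : ℕ} (x g : ℤ) (hg : 0 < g) (hgm : g < m) : (pairZ m x g).card = 2 := by
  rw [pairZ, card_insert_of_notMem, card_singleton]
  rw [mem_singleton]
  intro h
  have h0 : ((g : ℤ) : ZMod m) = 0 := by
    have : ((x + g : ℤ) : ZMod m) - (x : ZMod m) = 0 := by rw [← h, sub_self]
    simpa using this
  rw [ZMod.intCast_zmod_eq_zero_iff_dvd] at h0
  have := Int.eq_zero_of_dvd_of_natAbs_lt_natAbs h0 (by simp only [Int.natAbs_natCast]; omega)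
  omega

/-! ## Packaging -/

/-- **For every `k` and every `m ≥ 8k(k−1) + 8`, the cyclic group `ℤ/mℤ` admits `k` simultaneous-TPP triples of
2-subsets** (the pattern `(2,2,2)^k` of the census).  Symbolic in `k`; e.g. `k = 1, 2, 3, 4, 5` give `m ≥ 8, 24, 56, 104,
168`.  [cite: CohnKleinbergSzegedyUmans2005, Def. 5.1] -/
theorem exists_isSTPP_222pow_zmod (k m : ℕ) (hm : 8 * k * (k - 1) + 8 ≤ m) :
    ∃ A B C : Fin k → Finset (ZMod m), IsSTPP A B C ∧
      ∀ i, (A i).card = 2 ∧ (B i).card = 2 ∧ (C i).card = 2 := by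
  refine ⟨powFamA m k, powFamB m k, powFamC m k, isSTPP_powFam m k hm, fun i => ?_⟩
  have hm8 : (8 : ℤ) ≤ m := by have : 8 ≤ m := le_trans (Nat.le_add_left 8 _) hm; omega
  exact ⟨card_pairZ _ _ (by norm_num) (by omega), card_pairZ _ _ (by norm_num) (by omega),
    card_pairZ _ _ (by norm_num) (by omega)⟩

/-- Transport of a `(2,2,2)^N` statement along an injective additive hom. [cite: CohnKleinbergSzegedyUmans2005, Def. 5.1] -/
theorem exists_isSTPP_222pow_of_injective {H G : Type*} [AddCommGroup H] [AddCommGroup G] {N : ℕ}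
    (φ : H →+ G) (hφ : Function.Injective φ)
    (h : ∃ A B C : Fin N → Finset H, IsSTPP A B C ∧ ∀ i, (A i).card = 2 ∧ (B i).card = 2 ∧ (C i).card = 2) :
    ∃ A B C : Fin N → Finset G, IsSTPP A B C ∧ ∀ i, (A i).card = 2 ∧ (B i).card = 2 ∧ (C i).card = 2 := by
  classical
  obtain ⟨A, B, C, hS, hc⟩ := h
  refine ⟨fun i => (A i).image φ, fun i => (B i).image φ, fun i => (C i).image φ, hS.image φ hφ,
    fun i => ?_⟩
  obtain ⟨hA, hB, hC⟩ := hc i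
  exact ⟨by rw [card_image_of_injective _ hφ, hA], by rw [card_image_of_injective _ hφ, hB],
    by rw [card_image_of_injective _ hφ, hC]⟩

/-- **An abelian group with an element of additive order `≥ 8k(k−1) + 8` admits `(2,2,2)^k`** (transport along the
injection `ℤ/(ord g) ↪ G` of `STPP222CubeExponent.lean`). [cite: CohnKleinbergSzegedyUmans2005, Def. 5.1] -/
theorem exists_isSTPP_222pow_of_addOrderOf {G : Type*} [AddCommGroup G] (k : ℕ) (g : G)
    (hg : 8 * k * (k - 1) + 8 ≤ addOrderOf g) :
    ∃ A B C : Fin k → Finset G, IsSTPP A B C ∧ ∀ i, (A i).card = 2 ∧ (B i).card = 2 ∧ (C i).card = 2 :=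
  exists_isSTPP_222pow_of_injective _ (zmod_lift_zmultiples_injective g)
    (exists_isSTPP_222pow_zmod k (addOrderOf g) hg)

/-- **A finite abelian group of exponent `≥ 8k(k−1) + 8` admits `(2,2,2)^k`.** In the census notation:
`N_k(cyclic) ≤ 8k² − 8k + 8` (an upper law for STRUCTURE.md Q7; no sharpness claimed).
[cite: CohnKleinbergSzegedyUmans2005, Def. 5.1] -/
theorem exists_isSTPP_222pow_of_exponent {G : Type*} [AddCommGroup G] [Finite G] (k : ℕ)
    (h : 8 * k * (k - 1) + 8 ≤ AddMonoid.exponent G) :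
    ∃ A B C : Fin k → Finset G, IsSTPP A B C ∧ ∀ i, (A i).card = 2 ∧ (B i).card = 2 ∧ (C i).card = 2 := by
  obtain ⟨g, hg⟩ := AddMonoid.exists_addOrderOf_eq_exponent (AddMonoid.ExponentExists.of_finite (G := G))
  exact exists_isSTPP_222pow_of_addOrderOf k g (by rw [hg]; exact h)

/-! ## `k = 4`: an explicit integer witness with `M = 98` (every `ℤ/mℤ`, `m ≥ 99`)

The uniform family gives `m ≥ 104` at `k = 4`.  A search output (simulated annealing over integer families; its
provenance is irrelevant since the kernel re-checks it) does slightly better: the integer family below passes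
`stppCheck` in `ℤ` and all its `4³·2⁶ = 4096` constraint expressions have absolute value `≤ 98`, so by the transfer
lemma `stppCheck_map_intCast_zmod` of `STPP222CubeCyclic.lean` it is a `(2,2,2)⁴` family in `ZMod m` for every `m ≥ 99`.
No minimality of `98` is claimed. -/

/-- `k = 4` integer witness, `A`-pairs. -/
def int2224A : Fin 4 → ℤ × ℤ := ![(0, 41), (0, 2), (0, 2), (0, 1)]

/-- `k = 4` integer witness, `B`-pairs. -/
def int2224B : Fin 4 → ℤ × ℤ := ![(29, 30), (-6, -2), (67, 68), (38, 55)]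

/-- `k = 4` integer witness, `C`-pairs. -/
def int2224C : Fin 4 → ℤ × ℤ := ![(37, 39), (13, 14), (21, 30), (33, 35)]

/-- The `k = 4` integer witness satisfies CKSU Def. 5.1 in `ℤ` (kernel evaluation of `stppCheck`).
[cite: CohnKleinbergSzegedyUmans2005, Def. 5.1] -/
theorem stppCheck_int2224 :
    stppCheck (fun i => pairList (int2224A i)) (fun i => pairList (int2224B i))
      (fun i => pairList (int2224C i)) = true := by
  decide +kernel

/-- Every constraint expression of the `k = 4` integer witness has absolute value at most `98` (kernel). -/
theorem stppExprBound_int2224 :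
    stppExprBound (fun i => pairList (int2224A i)) (fun i => pairList (int2224B i))
      (fun i => pairList (int2224C i)) 98 = true := by
  decide +kernel

/-- The twelve pairs of the `k = 4` witness have distinct entries at distance `≤ 41` (kernel). -/
theorem pairGap_int2224 : ∀ i : Fin 4,
    ((int2224A i).1 ≠ (int2224A i).2 ∧ ((int2224A i).2 - (int2224A i).1).natAbs ≤ 41) ∧
    ((int2224B i).1 ≠ (int2224B i).2 ∧ ((int2224B i).2 - (int2224B i).1).natAbs ≤ 41) ∧
    ((int2224C i).1 ≠ (int2224C i).2 ∧ ((int2224C i).2 - (int2224C i).1).natAbs ≤ 41) := by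
  decide

/-- **Every cyclic group `ℤ/mℤ` with `m ≥ 99` admits the STPP pattern `(2,2,2)⁴`** (four triples of 2-subsets with
the simultaneous TPP): the `k = 4` integer witness reduced `mod m`.  Improves the uniform-family value `104` at `k = 4`;
the census (C6 / P-012) has `(2,2,2)⁴` infeasible in every abelian group of order `42–48` by complete search (engine
results, not used here). [cite: CohnKleinbergSzegedyUmans2005, Def. 5.1] -/
theorem exists_isSTPP_2224_zmod (m : ℕ) (hm : 99 ≤ m) :
    ∃ A B C : Fin 4 → Finset (ZMod m), IsSTPP A B C ∧ ∀ i, (A i).card = 2 ∧ (B i).card = 2 ∧ (C i).card = 2 := by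
  refine ⟨_, _, _, isSTPP_of_stppCheck (stppCheck_map_intCast_zmod stppCheck_int2224 stppExprBound_int2224
    (show 98 < m by omega)), fun i => ?_⟩
  obtain ⟨⟨hA1, hA2⟩, ⟨hB1, hB2⟩, ⟨hC1, hC2⟩⟩ := pairGap_int2224 i
  exact ⟨card_toFinset_map_pair hA1 (by omega), card_toFinset_map_pair hB1 (by omega),
    card_toFinset_map_pair hC1 (by omega)⟩

/-- Hence every abelian group with an element of additive order `≥ 99` admits `(2,2,2)⁴`.
[cite: CohnKleinbergSzegedyUmans2005, Def. 5.1] -/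
theorem exists_isSTPP_2224_of_addOrderOf {G : Type*} [AddCommGroup G] (g : G) (hg : 99 ≤ addOrderOf g) :
    ∃ A B C : Fin 4 → Finset G, IsSTPP A B C ∧ ∀ i, (A i).card = 2 ∧ (B i).card = 2 ∧ (C i).card = 2 :=
  exists_isSTPP_222pow_of_injective _ (zmod_lift_zmultiples_injective g) (exists_isSTPP_2224_zmod _ hg)

/-! ## The matching packing LOWER bound: `(2,2,2)^k` needs `|G| ≥ 8k − 4` -/

/-- **Packing lower bound for `(2,2,2)^k`** (the census filter N5 = `stpp_sum_erase_card_mul_add_sum_card_mul_le` of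
`STPPDisjointPacking.lean`, specialised): if a finite abelian group `G` carries `k` simultaneous-TPP triples of
2-subsets then `8k − 4 ≤ |G|`.  With `exists_isSTPP_222pow_zmod` this brackets the cyclic threshold of STRUCTURE.md Q7:
`8k − 4 ≤ n_k ≤ N_k(cyclic) ≤ 8k² − 8k + 8`. [cite: CohnKleinbergSzegedyUmans2005, Def. 5.1] -/
theorem card_ge_of_isSTPP_222pow {G : Type*} [AddCommGroup G] [Fintype G] {k : ℕ} {A B C : Fin k → Finset G}
    (hS : IsSTPP A B C) (hc : ∀ i, (A i).card = 2 ∧ (B i).card = 2 ∧ (C i).card = 2) :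
    8 * k - 4 ≤ Fintype.card G := by
  classical
  rcases Nat.eq_zero_or_pos k with hk | hk
  · subst hk; simp
  · have hA : ∀ i, (A i).Nonempty := fun i => Finset.card_pos.1 (by rw [(hc i).1]; norm_num)
    have hB : ∀ i, (B i).Nonempty := fun i => Finset.card_pos.1 (by rw [(hc i).2.1]; norm_num)
    have h := stpp_sum_erase_card_mul_add_sum_card_mul_le hS hA hB ⟨0, hk⟩
    have hBC : ∀ j, (B j).card * (C j).card = 4 := fun j => by rw [(hc j).2.1, (hc j).2.2]
    have hAC : ∀ j, (A j).card * (C j).card = 4 := fun j => by rw [(hc j).1, (hc j).2.2]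
    simp only [hBC, hAC, Finset.sum_const, smul_eq_mul, Finset.card_univ, Fintype.card_fin,
      Finset.card_erase_of_mem (Finset.mem_univ (⟨0, hk⟩ : Fin k))] at h
    omega

/-- The same bound for `ℤ/mℤ`: `(2,2,2)^k ⊆ ℤ/mℤ` with `m ≥ 1` forces `8k − 4 ≤ m`. [cite: CohnKleinbergSzegedyUmans2005, Def. 5.1] -/
theorem le_of_isSTPP_222pow_zmod {m k : ℕ} [NeZero m] {A B C : Fin k → Finset (ZMod m)} (hS : IsSTPP A B C)
    (hc : ∀ i, (A i).card = 2 ∧ (B i).card = 2 ∧ (C i).card = 2) : 8 * k - 4 ≤ m := by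
  simpa [ZMod.card] using card_ge_of_isSTPP_222pow hS hc

end Summit.MatrixMultiplication.OmegaCensus
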